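import Summits.HodgeConjecture.HodgeConjecture.Theorems.WeilTypeLadder
import Summits.HodgeConjecture.HodgeConjecture.Theses.HeckePrymWeil
import Literature.AlgebraicGeometry.HodgeTheory.WeilClasses
import HarnessLib

/-!
# WeilTypeLadder · arrow crux `HeckePrymWeil.HyperbolicEightfoldsSqrtMinus7` (stmt-HodgeConjecture-14642) ⟶ R2₈[d = 7]

b2b cell `hweil`, CLAIM TABLE row P1 (iii) (LADDER.md §5; DIVERGENCE.md D7). The route crux
`Theses.HeckePrymWeil.HyperbolicEightfoldsSqrtMinus7` concludes algebraicity for every rational `(4,4)`-class in the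
LARGER eigen-plane `Eig((𝟙+φ)^*, (1+i√7)⁸) ⊔ Eig((𝟙+φ)^*, (1-i√7)⁸) ⊆ H⁸(A(ℂ); ℂ)` of a hyperbolic ℚ(√-7)-Weil
eightfold, while the ladder rung `WeilTypeLadder.SplitEightfolds` (R2₈) asks it for the classes of the Weil plane
`weilClassesOf A φ 4 7 = E₊ ⊔ E₋` (joint eigenclasses of ALL `(x·𝟙 + y·φ)^*`). Since `E± ≤ Eig((𝟙+φ)^*, (1 ± i√7)⁸)`
(instantiate the joint eigen-condition at `x = y = 1`), the crux implies the `d = 7` slice of R2₈ (and the slice does not need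
the rung's `IsSmoothProjective` hypothesis). The converse would need eigenvalue separation on `H⁸ = ⋀⁸H¹` and is not claimed.

Serves stmt-HodgeConjecture-14642 (what it implies) without closing it. No facts, no sorries.
-/

noncomputable section

-- every declaration of this problem lives in `Summit.HodgeConjecture.HodgeConjecture.…` (summit = sub-problem)
set_option linter.dupNamespace false

open CategoryTheory
open Literature.AlgebraicGeometry Literature.AlgebraicGeometry.Motives
open Literature.AlgebraicGeometry.HodgeTheory
open Literature.AlgebraicTopology.SingularHomology

namespace Summit.HodgeConjecture.HodgeConjecture.WeilTypeLadder

/-- `E₊ ≤ Eig((𝟙+φ)^*, (1 + i√d)^{2n})`: a joint eigenclass of all `(x·𝟙 + y·φ)^*` with characters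
`(x + y i√d)^{2n}` is in particular an eigenclass of `(𝟙 + φ)^*` (`x = y = 1`). -/
theorem weilClassesPlus_le_eigenspace (A : Motives.AbelianVariety ℂ) (φ : A ⟶ A) (n d : ℕ) :
    weilClassesPlus A φ n d ≤
      Module.End.eigenspace (complexBetti.map (𝟙 A + φ).hom.hom.hom (2 * n)).hom
        ((1 + Complex.I * (Real.sqrt d : ℂ)) ^ (2 * n)) := by
  intro c hc
  rw [Module.End.mem_eigenspace_iff]
  have h := (mem_weilClassesPlus_iff.mp hc) 1 1
  simp only [one_smul, Nat.cast_one, one_mul] at h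
  exact h

/-- `E₋ ≤ Eig((𝟙+φ)^*, (1 - i√d)^{2n})` (same argument with the conjugate character). -/
theorem weilClassesMinus_le_eigenspace (A : Motives.AbelianVariety ℂ) (φ : A ⟶ A) (n d : ℕ) :
    weilClassesMinus A φ n d ≤
      Module.End.eigenspace (complexBetti.map (𝟙 A + φ).hom.hom.hom (2 * n)).hom
        ((1 - Complex.I * (Real.sqrt d : ℂ)) ^ (2 * n)) := by
  intro c hc
  rw [Module.End.mem_eigenspace_iff]
  have h := (mem_weilClassesMinus_iff.mp hc) 1 1
  simp only [one_smul, Nat.cast_one, one_mul] at h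
  exact h

/-- The Weil plane sits in the crux's eigen-plane: `E₊ ⊔ E₋ ≤ Eig((𝟙+φ)^*,(1+i√d)^{2n}) ⊔ Eig((𝟙+φ)^*,(1-i√d)^{2n})`. -/
theorem weilClassesOf_le_eigenspace_sup (A : Motives.AbelianVariety ℂ) (φ : A ⟶ A) (n d : ℕ) :
    weilClassesOf A φ n d ≤
      Module.End.eigenspace (complexBetti.map (𝟙 A + φ).hom.hom.hom (2 * n)).hom
          ((1 + Complex.I * (Real.sqrt d : ℂ)) ^ (2 * n)) ⊔
        Module.End.eigenspace (complexBetti.map (𝟙 A + φ).hom.hom.hom (2 * n)).hom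
          ((1 - Complex.I * (Real.sqrt d : ℂ)) ^ (2 * n)) :=
  sup_le_sup (weilClassesPlus_le_eigenspace A φ n d) (weilClassesMinus_le_eigenspace A φ n d)

/-- **ARROW crux 14642 ⟶ R2₈[d = 7].** `HeckePrymWeil.HyperbolicEightfoldsSqrtMinus7` (algebraicity on the
eigen-plane of `(𝟙+φ)^*`) implies the `d = 7` slice of `WeilTypeLadder.SplitEightfolds` (algebraicity on the Weil plane
`weilClassesOf A φ 4 7`), for every hyperbolic `K`-symmetrised hyperplane class; the slice is stated verbatim as R2₈ with
`d := 7` (its `IsSmoothProjective` hypothesis is not even used). -/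
theorem splitEightfolds_seven_of_hyperbolicEightfoldsSqrtMinus7
    (h : Theses.HeckePrymWeil.HyperbolicEightfoldsSqrtMinus7) :
    ∀ (A : Motives.AbelianVariety ℂ) (φ : A ⟶ A), A.dim = 2 * 4 →
      Motives.IsSmoothProjective (2 * 4) A.X → φ ≫ φ = -((7 : ℕ) • 𝟙 A) →
        ∀ (e : Motives.ProjectiveEmbedding A.X)
          (a : complexBetti (Motives.projectiveSpace e.n ℂ) 2), IsRationalClass a → a ≠ 0 →
          Motives.IsHyperbolicWeilType A φ 4
            ((((7 : ℕ) : ℂ)) • complexBetti.map e.ι 2 a +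
              complexBetti.map φ.hom.hom.hom 2 (complexBetti.map e.ι 2 a)) →
            ∀ c : complexBetti A.X (2 * 4), IsRationalClass c →
              IsOfHodgeType (2 * 4) A.X (2 * 4) 4 4 c → c ∈ weilClassesOf A φ 4 7 →
                c ∈ algebraicClasses A.X 4 := by
  intro A φ hA _hX hφ e a ha ha0 hh c hc h44 hW
  have hφ' : φ ≫ φ = -((7 : ℤ) • 𝟙 A) := by
    rw [hφ]
    norm_cast
  have hh' : Motives.IsHyperbolicWeilType A φ 4
      ((7 : ℂ) • complexBetti.map e.ι 2 a + complexBetti.map φ.hom.hom.hom 2 (complexBetti.map e.ι 2 a)) := by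
    simpa using hh
  exact h A φ hA hφ' e a ha ha0 hh' c hc h44 (weilClassesOf_le_eigenspace_sup A φ 4 7 hW)

/-- The same slice from the rung itself (R2₈ at `d = 7`), for comparison: both the crux and the rung imply it. -/
theorem splitEightfolds_seven_of_splitEightfolds (h : SplitEightfolds) :
    ∀ (A : Motives.AbelianVariety ℂ) (φ : A ⟶ A), A.dim = 2 * 4 →
      Motives.IsSmoothProjective (2 * 4) A.X → φ ≫ φ = -((7 : ℕ) • 𝟙 A) →
        ∀ (e : Motives.ProjectiveEmbedding A.X)
          (a : complexBetti (Motives.projectiveSpace e.n ℂ) 2), IsRationalClass a → a ≠ 0 →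
          Motives.IsHyperbolicWeilType A φ 4
            ((((7 : ℕ) : ℂ)) • complexBetti.map e.ι 2 a +
              complexBetti.map φ.hom.hom.hom 2 (complexBetti.map e.ι 2 a)) →
            ∀ c : complexBetti A.X (2 * 4), IsRationalClass c →
              IsOfHodgeType (2 * 4) A.X (2 * 4) 4 4 c → c ∈ weilClassesOf A φ 4 7 →
                c ∈ algebraicClasses A.X 4 :=
  h 7 (by norm_num)

end Summit.HodgeConjecture.HodgeConjecture.WeilTypeLadder

end
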